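import Summits.AtomisticToContinuum.Crystallization.Theorems.FluxTubeKeplerFloorGivesLayered
import Summits.AtomisticToContinuum.Crystallization.Theorems.FluxTubeKeplerFluxCellKeplerSingleScale

/-!
# `AffineBlindRung` — F3 special-case certificate (no `sorry`)

Forward rung over `FluxTubeKepler.FloorGivesLayered` (crux dir `FluxCellKepler`, stmt-AtomisticToContinuum-15221;
fwd-rung G1 gen 9).  This file re-declares the rung family of `Lines/AffineBlindRung.lean` in its own namespace
(`…AffineLadder.Special`, so that it never collides with the skeleton file) and proves, sorry-free:

* `affGood_zero_iff` — at strain budget `κ = 0` the affine-good predicate IS the floor's `LayeredGood R η`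
  (`‖M − 1‖ ≤ 0` forces `M = 1`): the dial value `0` is the floor by one hypothesis move, no re-indexing;
* `affRung_zero : AffRung 0` — **the F3 witness**: the floor's proved theorem
  `FluxTubeKeplerFloorGivesLayered.FloorGivesLayered_proof` composed with the proved `PeriodicGivenLayered_holds`;
* `affRung_anti` — the dial is antitone in `κ` (a budget blind to more strains is a weaker hypothesis, so the
  rung with larger `κ` is the stronger statement); `affRung_zero_of_affineBlindRung` — the rung gives back the floor.
-/

noncomputable section

namespace Summit.AtomisticToContinuum.Crystallization.Cruxes.FluxCellKepler.AffineLadder.Special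

open scoped BigOperators Classical
open Filter Topology
open Literature.MathematicalPhysics.StatisticalMechanics
open Summit.AtomisticToContinuum.Crystallization.Theorems.FluxCellKeplerSingleScale
  (LayeredGood layeredGood_mono)

local notation "E3" => EuclideanSpace ℝ (Fin 3)

/-- FLOOR(P₀): `N · e(P₀) ≤ E(x)` for every Lennard-Jones ground state (verbatim the floor's first hypothesis). -/
def Floor (P₀ : PeriodicConfiguration 3) : Prop :=
  ∀ (N : ℕ) (x : Fin N → E3), IsGroundState lennardJones x →
    (N : ℝ) * P₀.energyPerParticle lennardJones ≤ interactionEnergy lennardJones x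

/-- `κ`-AFFINE-GOOD SITE: some admissible layered template (spacing `a ∈ [47/50, 1]`, Hägg word `s`, Barlow
registry, gaps in `[39a/50, 17a/20]`, rigid motion `A`) deformed by a homogeneous linear STRAIN `M` with
`‖M − 1‖ ≤ κ` — template points `A (M p)` — matches the `R`-ball around `x i` two-way with tolerance `η`.
`κ = 0`: `M = 1`, the floor's predicate `LayeredGood R η` (`affGood_zero_iff`). -/
def AffGood (κ R η : ℝ) {N : ℕ} (x : Fin N → E3) (i : Fin N) : Prop :=
  ∃ M : E3 →L[ℝ] E3, ‖M - 1‖ ≤ κ ∧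
  ∃ a : ℝ, 47 / 50 ≤ a ∧ a ≤ 1 ∧ ∃ (A : E3 →ₗᵢ[ℝ] E3) (s : ℤ → ℤ) (z : ℤ → ℝ), IsHaggSeq s ∧
    (∀ m : ℤ, 39 / 50 * a ≤ z (m + 1) - z m ∧ z (m + 1) - z m ≤ 17 / 20 * a) ∧
    let S : Set E3 := {p | ∃ m k l : ℤ, p = A (M (((k : ℝ) • triangularVec₁ a) + ((l : ℝ) • triangularVec₂ a) +
      ((haggLabel s m : ℝ) • barlowOffset a) + (z m • layerNormal 1)))}
    (∀ p ∈ S, ‖p‖ ≤ R → ∃ j : Fin N, dist (x j - x i) p ≤ η) ∧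
    (∀ j : Fin N, ‖x j - x i‖ ≤ R → ∃ p ∈ S, dist (x j - x i) p ≤ η)

/-- AFFINE-BLIND BUDGET with dial `κ`: at every scale `(R,η)` some `c > 0` prices the sites that are not
`κ`-affine-good against the excess energy over `N · e(P₀)` (`κ = 0`: the floor's budget). -/
def AffBudget (κ : ℝ) (P₀ : PeriodicConfiguration 3) : Prop :=
  ∀ R η : ℝ, 0 < R → 0 < η → ∃ c : ℝ, 0 < c ∧
    ∀ (N : ℕ) (x : Fin N → E3), IsGroundState lennardJones x →
      c * (Nat.card {i : Fin N // ¬ AffGood κ R η x i} : ℝ) ≤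
        interactionEnergy lennardJones x - (N : ℝ) * P₀.energyPerParticle lennardJones

/-- Periodic windows at every scale along `x` (verbatim the conclusion of `FluxTubeKepler.PeriodicGivenLayered`). -/
def HasPeriodicWindows (x : (N : ℕ) → (Fin N → E3)) : Prop :=
  ∃ P : PeriodicConfiguration 3, ∀ R ε : ℝ, 0 < ε → ∃ᶠ N in atTop, ∃ t : E3,
    (∀ s ∈ P.points, ‖s‖ ≤ R → ∃ i : Fin N, dist (x N i + t) s ≤ ε) ∧
    (∀ i : Fin N, ‖x N i + t‖ ≤ R → ∃ s ∈ P.points, dist (x N i + t) s ≤ ε)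

/-- **The graded family.** `AffRung κ`: FLOOR and the budget that leaves strains of size `≤ κ` unpriced force
periodic windows along every Lennard-Jones ground-state sequence. -/
def AffRung (κ : ℝ) : Prop :=
  ∀ P₀ : PeriodicConfiguration 3, Floor P₀ → AffBudget κ P₀ →
    ∀ x : (N : ℕ) → (Fin N → E3), (∀ N, IsGroundState lennardJones (x N)) → HasPeriodicWindows x

/-- **Deciding rung.** For SOME positive strain allowance `κ` the budget need not price the elastic STRAIN of the
perfect material at all: pricing only the sites whose `R`-neighbourhood is not `η`-close to an admissible layered
template deformed by a homogeneous strain of size `≤ κ` suffices — the strain of the windows (zero) is then selected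
by the energy. -/
def AffineBlindRung : Prop := ∃ κ : ℝ, 0 < κ ∧ AffRung κ

/-! ## Predicate bookkeeping -/

theorem affGood_mono {κ κ' : ℝ} (hκ : κ ≤ κ') {R η : ℝ} {N : ℕ} (x : Fin N → E3) (i : Fin N) :
    AffGood κ R η x i → AffGood κ' R η x i := by
  rintro ⟨M, hM, a, ha₁, ha₂, A, s, z, hs, hz, h₁, h₂⟩
  exact ⟨M, hM.trans hκ, a, ha₁, ha₂, A, s, z, hs, hz, h₁, h₂⟩

theorem layeredGood_of_affGood_zero {R η : ℝ} {N : ℕ} (x : Fin N → E3) (i : Fin N) :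
    AffGood 0 R η x i → LayeredGood R η x i := by
  rintro ⟨M, hM, a, ha₁, ha₂, A, s, z, hs, hz, h₁, h₂⟩
  have hM1 : M = 1 := sub_eq_zero.mp (norm_le_zero_iff.mp hM)
  subst hM1
  refine ⟨a, ha₁, ha₂, A, s, z, hs, hz, ?_, ?_⟩
  · intro p hp hpR
    obtain ⟨m, k, l, rfl⟩ := hp
    exact h₁ _ ⟨m, k, l, by simp⟩ hpR
  · intro j hj
    obtain ⟨p, hp, hjp⟩ := h₂ j hj
    obtain ⟨m, k, l, rfl⟩ := hp
    exact ⟨_, ⟨m, k, l, rfl⟩, by simpa using hjp⟩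

theorem affGood_zero_of_layeredGood {R η : ℝ} {N : ℕ} (x : Fin N → E3) (i : Fin N) :
    LayeredGood R η x i → AffGood 0 R η x i := by
  rintro ⟨a, ha₁, ha₂, A, s, z, hs, hz, h₁, h₂⟩
  refine ⟨1, by simp, a, ha₁, ha₂, A, s, z, hs, hz, ?_, ?_⟩
  · intro p hp hpR
    obtain ⟨m, k, l, rfl⟩ := hp
    exact h₁ _ ⟨m, k, l, by simp⟩ (by simpa using hpR)
  · intro j hj
    obtain ⟨p, hp, hjp⟩ := h₂ j hj
    obtain ⟨m, k, l, rfl⟩ := hp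
    exact ⟨_, ⟨m, k, l, rfl⟩, by simpa using hjp⟩

/-- The floor's predicate is the member `κ = 0` of the family (`‖M − 1‖ ≤ 0 ↔ M = 1`). -/
theorem affGood_zero_iff {R η : ℝ} {N : ℕ} (x : Fin N → E3) (i : Fin N) :
    AffGood 0 R η x i ↔ LayeredGood R η x i :=
  ⟨layeredGood_of_affGood_zero x i, affGood_zero_of_layeredGood x i⟩

/-- `AffGood κ` is antitone in the radius and monotone in the tolerance. [folklore] -/
theorem affGood_mono_scale {κ R R' η η' : ℝ} (hR : R ≤ R') (hη : η' ≤ η) {N : ℕ}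
    (x : Fin N → E3) (i : Fin N) : AffGood κ R' η' x i → AffGood κ R η x i := by
  rintro ⟨M, hM, a, ha₁, ha₂, A, s, z, hs, hz, h₁, h₂⟩
  refine ⟨M, hM, a, ha₁, ha₂, A, s, z, hs, hz, ?_, ?_⟩
  · intro p hp hpR
    obtain ⟨j, hj⟩ := h₁ p hp (hpR.trans hR)
    exact ⟨j, hj.trans hη⟩
  · intro j hj
    obtain ⟨p, hp, hjp⟩ := h₂ j (hj.trans hR)
    exact ⟨p, hp, hjp.trans hη⟩

/-- The budget is monotone in the dial: a budget pricing the larger bad set prices the smaller one. -/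
theorem affBudget_mono {κ κ' : ℝ} (hκ : κ ≤ κ') (P₀ : PeriodicConfiguration 3) :
    AffBudget κ P₀ → AffBudget κ' P₀ := by
  intro hB R η hR hη
  obtain ⟨c, hc, hcB⟩ := hB R η hR hη
  refine ⟨c, hc, fun N x hx => le_trans ?_ (hcB N x hx)⟩
  have hle : Nat.card {i : Fin N // ¬ AffGood κ' R η x i} ≤ Nat.card {i : Fin N // ¬ AffGood κ R η x i} := by
    rw [Nat.card_eq_fintype_card, Nat.card_eq_fintype_card]
    exact Fintype.card_subtype_mono _ _ fun i hi hg => hi (affGood_mono hκ x i hg)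
  exact mul_le_mul_of_nonneg_left (by exact_mod_cast hle) hc.le

/-! ## F3 — the family specialises to the proved floor -/

/-- `AffRung 0` is the floor: the seed theorem followed by the proved `PeriodicGivenLayered`. -/
theorem affRung_zero : AffRung 0 := by
  intro P₀ hF hB x hx
  refine Theses.FluxTubeKepler.PeriodicGivenLayered_holds x hx
    (Theorems.FluxTubeKeplerFloorGivesLayered.FloorGivesLayered_proof P₀ hF ?_ x hx)
  intro R η hR hη
  obtain ⟨c, hc, hcB⟩ := hB R η hR hη
  refine ⟨c, hc, fun N y hy => ?_⟩
  show c * (Nat.card {i : Fin N // ¬ LayeredGood R η y i} : ℝ) ≤ _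
  refine le_trans ?_ (hcB N y hy)
  have hle : Nat.card {i : Fin N // ¬ LayeredGood R η y i} ≤
      Nat.card {i : Fin N // ¬ AffGood 0 R η y i} := by
    rw [Nat.card_eq_fintype_card, Nat.card_eq_fintype_card]
    exact Fintype.card_subtype_mono _ _ fun i hi hg => hi (layeredGood_of_affGood_zero y i hg)
  exact mul_le_mul_of_nonneg_left (by exact_mod_cast hle) hc.le

/-! ## Dial monotonicity (harder-to-easier = shrinking the unpriced strain allowance `κ`) -/

theorem affRung_anti {κ κ' : ℝ} (hκ : κ ≤ κ') : AffRung κ' → AffRung κ :=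
  fun H P₀ hF hB x hx => H P₀ hF (affBudget_mono hκ P₀ hB) x hx

/-- The deciding rung gives every member `AffRung κ'` with `κ'` at most its witness, in particular the floor
(informational `specialises`). -/
theorem affRung_zero_of_affineBlindRung (h : AffineBlindRung) : AffRung 0 := by
  obtain ⟨κ, hκ, hR⟩ := h
  exact affRung_anti hκ.le hR

end Summit.AtomisticToContinuum.Crystallization.Cruxes.FluxCellKepler.AffineLadder.Special

end
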